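import Summits.RiemannHypothesis.RiemannHypothesis.Theorems.Splittings.RobinFiniteReflLow

/-!
# RobinFiniteReflLowRanges — concrete ranges of the halved low-height law (SPLIT-robin-finite gen 14, part 3/4)

Cell rh-split, card `cards/SPLIT-robin-finite.md` §21.  HONEST LABEL: «SPLITTING SEARCH over kernel-typed RH-EQUIVALENCES; a splitting A ∧ B ⟹ RH is CONDITIONAL bookkeeping unless A and B
are both proved; nothing here bears on the truth of RH.»

At every height `T ∈ [10⁵, H₀)` the admissible prime range `X(T)` of gen 11 (`RobinFiniteLowHeightRanges`) is multiplied by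
`4` (one more certified level in the cells regime; `(19/3.3)` resp. `4.2×` on the ramps), from the same published inputs:
RH to `160 000` ⟹ primes `< 4¹⁴` (tree: needs `330 000`); RH to `1.62·10⁶` ⟹ all seven levels `< 4¹⁸` (tree: `3·10⁶`);
RH to the 1986 height ⟹ primes `≤ 1.9·10¹⁴`, all `n ≤ 10^(8·10¹³)` (tree: `3.3·10¹³`, `10^(1.4·10¹³)`); RH to Platt's 2017
height ⟹ primes `≤ 4.2·10¹⁷`, all `n ≤ 10^(1.8·10¹⁷)` (tree: `10¹⁷`, `10^(4·10¹⁶)`).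
-/

set_option linter.dupNamespace false

noncomputable section

open Real Filter Finset
open scoped Chebyshev ComplexConjugate

namespace Summit.RiemannHypothesis.RiemannHypothesis.Theorems.Splittings.RobinFiniteC1

open Literature.NumberTheory.LFunctions Literature.NumberTheory.DiophantineGeometry
open Literature.NumberTheory.LFunctions.SchoenfeldBound
open Literature.NumberTheory.LFunctions.NicolasJExplicit
open RobinAnalyticSharp RobinAnalyticSharp.Cells
open Summit.RiemannHypothesis.RiemannHypothesis.Theorems.Splittings.RobinFiniteE3
open Summit.RiemannHypothesis.RiemannHypothesis.Theorems.Splittings.RobinFiniteTail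
  (zeroTailBound_tailH tailH_PT_le tailH_nonneg tailH_1e5_le)
open Summit.RiemannHypothesis.RiemannHypothesis.Theorems.Splittings.RobinFiniteE1c (summable_tailTerm)

section ReflLowRanges

/-! ### R2 · concrete ranges of the HALVED low-height law (tree `RobinFiniteLowHeightRanges`, gen 11, same heights) -/

/-- HALVED per-level tail tolerances (the exact margins `(b_k − 0.0463)/((1 + 2/L1 k)·(2^{k+1} + 2^{−(k+1)})/2)` rounded down;
each is `2·tol k` of the tree to four digits): level `k` passes as soon as `tailH(T) ≤ tolR k`. -/
def tolR : ℕ → ℚ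
  | 11 => 2533 / 10 ^ 8 | 12 => 3785 / 10 ^ 8 | 13 => 2787 / 10 ^ 8 | 14 => 1791 / 10 ^ 8
  | 15 => 1040 / 10 ^ 8 | 16 => 5930 / 10 ^ 9 | 17 => 3190 / 10 ^ 9 | _ => 0

/-- The HALVED level condition from the tolerance. -/
theorem level_of_tolR {t : ℝ} {k : ℕ} (hk11 : 11 ≤ k) (hk17 : k ≤ 17) (ht : t ≤ ((tolR k : ℚ) : ℝ)) :
    0.0463 + (1 + 2 / ((L1 k : ℚ) : ℝ)) * (t * (((2 : ℝ) ^ (k + 1) + ((2 : ℝ) ^ (k + 1))⁻¹) / 2)) ≤ ((bk k : ℚ) : ℝ) := by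
  interval_cases k <;>
    · simp only [tolR, bk, L1, l2] at ht ⊢; push_cast at ht ⊢; norm_num at ht ⊢; nlinarith [ht]

/-- **R2a · cells-only range at height `T`, HALVED**: if every level `11 ≤ k ≤ K` (`K ≤ 17`) has `tailH(T) ≤ tolR k`, then Robin
holds at every CA number `> 5040` with primes `< 4^{K+1}` (tree `robinCA_below_cells` with `tol k ≈ tolR k/2`). -/
theorem robinCA_below_cells_refl (h16 : Buthe2016_thm2) (hB : Buthe2018_thm2_theta)
    (hK : BroadbentEtAl2021_theta_rel_1e19) {T : ℝ} (hT : 100000 ≤ T) (hRH : RiemannHypothesisUpTo T)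
    {K : ℕ} (hK11 : 11 ≤ K) (hK17 : K ≤ 17)
    (htol : ∀ k : ℕ, 11 ≤ k → k ≤ K → ((Real.log (T / (2 * π)) + 1) / (π * T) + (184 + 30 * Real.log T) / T ^ 2) ≤ ((tolR k : ℚ) : ℝ)) :
    robinCA_below (4 ^ (K + 1)) := by
  have h1 : 1 ≤ 4 ^ (K + 1) := Nat.one_le_pow _ _ (by norm_num)
  rw [← Nat.sub_add_cancel h1]
  set X : ℕ := 4 ^ (K + 1) - 1 with hX_def
  have hXr : (X : ℝ) = (4 : ℝ) ^ (K + 1) - 1 := by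
    rw [hX_def, Nat.cast_sub h1]; push_cast; ring
  have hX18 : (X : ℝ) < (4 : ℝ) ^ 18 := by
    rw [hXr]; have : (4 : ℝ) ^ (K + 1) ≤ 4 ^ 18 := pow_le_pow_right₀ (by norm_num) (by omega); linarith
  refine robinCA_below_low_refl h16 hB hK hT hRH (X := X) ?_ ?_ ?_ ?_
  · intro k hk11 hk17 hkX
    have hkK : k ≤ K := by
      by_contra h
      push Not at h
      have : (4 : ℝ) ^ (K + 1) ≤ 4 ^ k := pow_le_pow_right₀ (by norm_num) (by omega)
      rw [hXr] at hkX; linarith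
    exact level_of_tolR hk11 hk17 (htol k hk11 hkK)
  · intro h; exfalso; linarith
  · intro h; exfalso; have : (4 : ℝ) ^ 18 ≤ (10 : ℝ) ^ 14 := by norm_num
    linarith
  · intro h; exfalso; have : (4 : ℝ) ^ 18 ≤ 2 * (10 : ℝ) ^ 19 := by norm_num
    linarith

/-- **R2b · RH to height `160 000` ⟹ Robin at every CA number `> 5040` with primes `< 4¹⁴ = 268 435 456`** (levels `11–13`,
`tailH ≤ 12/(π·160000) = 2.39·10⁻⁵ ≤ tolR 11 = 2.533·10⁻⁵`).  Tree (unpaired): the same range needs RH to height `330 000`. -/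
theorem robinCA_below_of_rh160000_refl (h16 : Buthe2016_thm2) (hB : Buthe2018_thm2_theta)
    (hK : BroadbentEtAl2021_theta_rel_1e19) {T : ℝ} (hT : 160000 ≤ T) (hRH : RiemannHypothesisUpTo T) :
    robinCA_below (4 ^ 14) := by
  have hπ := Real.pi_gt_d6
  refine robinCA_below_cells_refl h16 hB hK (by linarith) hRH (K := 13) (by norm_num) (by norm_num) fun k hk11 hk13 => ?_
  refine (tailH_le_of_height (n := 12) (by norm_num) (by norm_num) hT).trans ?_
  rw [div_le_iff₀ (by positivity)]
  interval_cases k <;> · simp only [tolR]; push_cast; nlinarith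

/-- **R2c · RH to height `330 000` ⟹ Robin at CA numbers with primes `< 4¹⁵ ≈ 1.07·10⁹`** (levels `11–14`; `tailH ≤ 13/(π·330000)
= 1.254·10⁻⁵ ≤ tolR 14 = 1.791·10⁻⁵`).  Tree at the same height: `< 4¹⁴` (`robinCA_below_of_rh330000`). -/
theorem robinCA_below_of_rh330000_refl (h16 : Buthe2016_thm2) (hB : Buthe2018_thm2_theta)
    (hK : BroadbentEtAl2021_theta_rel_1e19) {T : ℝ} (hT : 330000 ≤ T) (hRH : RiemannHypothesisUpTo T) :
    robinCA_below (4 ^ 15) := by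
  have hπ := Real.pi_gt_d6
  refine robinCA_below_cells_refl h16 hB hK (by linarith) hRH (K := 14) (by norm_num) (by norm_num) fun k hk11 hk13 => ?_
  refine (tailH_le_of_height (n := 13) (by norm_num) (by norm_num) hT).trans ?_
  rw [div_le_iff₀ (by positivity)]
  interval_cases k <;> · simp only [tolR]; push_cast; nlinarith

/-- **R2d · RH to height `500 000` ⟹ primes `< 4¹⁶ ≈ 4.29·10⁹`** (`14/(π·500000) = 8.92·10⁻⁶ ≤ tolR 15 = 1.040·10⁻⁵`).
Tree at the same height: `< 4¹⁵`. -/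
theorem robinCA_below_of_rh500000_refl (h16 : Buthe2016_thm2) (hB : Buthe2018_thm2_theta)
    (hK : BroadbentEtAl2021_theta_rel_1e19) {T : ℝ} (hT : 500000 ≤ T) (hRH : RiemannHypothesisUpTo T) :
    robinCA_below (4 ^ 16) := by
  have hπ := Real.pi_gt_d6
  refine robinCA_below_cells_refl h16 hB hK (by linarith) hRH (K := 15) (by norm_num) (by norm_num) fun k hk11 hk13 => ?_
  refine (tailH_le_of_height (n := 14) (by norm_num) (by norm_num) hT).trans ?_
  rw [div_le_iff₀ (by positivity)]
  interval_cases k <;> · simp only [tolR]; push_cast; nlinarith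

/-- **R2e · RH to height `860 000` — so RH to height `10⁶`, the next tree certificate — ⟹ primes `< 4¹⁷ ≈ 1.72·10¹⁰`**
(`14/(π·860000) = 5.18·10⁻⁶ ≤ tolR 16 = 5.93·10⁻⁶`).  Tree at the same height: `< 4¹⁶`. -/
theorem robinCA_below_of_rh860000_refl (h16 : Buthe2016_thm2) (hB : Buthe2018_thm2_theta)
    (hK : BroadbentEtAl2021_theta_rel_1e19) {T : ℝ} (hT : 860000 ≤ T) (hRH : RiemannHypothesisUpTo T) :
    robinCA_below (4 ^ 17) := by
  have hπ := Real.pi_gt_d6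
  refine robinCA_below_cells_refl h16 hB hK (by linarith) hRH (K := 16) (by norm_num) (by norm_num) fun k hk11 hk13 => ?_
  refine (tailH_le_of_height (n := 14) (by norm_num) (by norm_num) hT).trans ?_
  rw [div_le_iff₀ (by positivity)]
  interval_cases k <;> · simp only [tolR]; push_cast; nlinarith

/-- **R2f · RH to height `1 620 000` ⟹ primes `< 4¹⁸ ≈ 6.87·10¹⁰` — ALL SEVEN certified levels** (`15/(π·1620000) = 2.95·10⁻⁶
≤ tolR 17 = 3.19·10⁻⁶`).  Tree at the same height: `< 4¹⁷`; the tree needs RH to height `3·10⁶` for all seven levels. -/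
theorem robinCA_below_of_rh1620000_refl (h16 : Buthe2016_thm2) (hB : Buthe2018_thm2_theta)
    (hK : BroadbentEtAl2021_theta_rel_1e19) {T : ℝ} (hT : 1620000 ≤ T) (hRH : RiemannHypothesisUpTo T) :
    robinCA_below (4 ^ 18) := by
  have hπ := Real.pi_gt_d6
  refine robinCA_below_cells_refl h16 hB hK (by linarith) hRH (K := 17) (by norm_num) (by norm_num) fun k hk11 hk13 => ?_
  refine (tailH_le_of_height (n := 15) (by norm_num) (by norm_num) hT).trans ?_
  rw [div_le_iff₀ (by positivity)]
  interval_cases k <;> · simp only [tolR]; push_cast; nlinarith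

/-- `(s + s⁻¹)/2 ≤ (c + 1)/2` for `1 ≤ s ≤ c` (the mirror term `1/√X` never exceeds `1`). -/
theorem half_add_inv_le {s c : ℝ} (h1 : 1 ≤ s) (h2 : s ≤ c) : (s + s⁻¹) / 2 ≤ (c + 1) / 2 := by
  have : s⁻¹ ≤ 1 := inv_le_one_of_one_le₀ h1
  linarith

/-- **R2g · RH to the 1986 height `545 439 823` ⟹ Robin at every CA number `> 5040` with primes `≤ 1.9·10¹⁴`** (ramps 1a AND 1b:
`tailH ≤ 21/(πT) = 1.2256·10⁻⁸`; `(1 + 2/24.95)·tailH·(10⁷ + 1)/2 ≤ 0.0662`; `(1 + 2/32.236)·tailH·(√(1.9·10¹⁴) + 1)/2 ≤ 0.0898`).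
Tree at the same height: `≤ 3.3·10¹³` (`robinCA_below_of_rh1986`, ramp 1a only) — a factor `5.8`. -/
theorem robinCA_below_of_rh1986_refl (h16 : Buthe2016_thm2) (hB : Buthe2018_thm2_theta)
    (hK : BroadbentEtAl2021_theta_rel_1e19) {T : ℝ} (hT : 545439823 ≤ T) (hRH : RiemannHypothesisUpTo T) :
    robinCA_below (19 * 10 ^ 13 + 1) := by
  have hπ := Real.pi_gt_d6
  have hT5 : (100000 : ℝ) ≤ T := by linarith
  have hT7 : (7 : ℝ) ≤ T := by linarith
  have ht0 := tailH_nonneg hT7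
  have ht := tailH_le_of_height (n := 21) (by norm_num) (by norm_num) hT
  have ht' : ((Real.log (T / (2 * π)) + 1) / (π * T) + (184 + 30 * Real.log T) / T ^ 2) ≤ 21 / (3.141592 * 545439823) :=
    ht.trans (div_le_div_of_nonneg_left (by norm_num) (by positivity) (by nlinarith))
  have hmain := robinCA_below_low_refl h16 hB hK hT5 hRH (X := 19 * 10 ^ 13) ?_ ?_ ?_ ?_
  · exact hmain
  · intro k hk11 hk17 _
    refine level_of_tolR hk11 hk17 (ht'.trans ?_)
    interval_cases k <;> · simp only [tolR]; push_cast; norm_num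
  · intro _
    have hf : 1 + 2 / Real.log ((4 : ℝ) ^ 18) ≤ 1 + 2 / 24.95 := by
      have := log_four_pow_18_bounds.1
      have h : 2 / Real.log ((4 : ℝ) ^ 18) ≤ 2 / 24.95 := div_le_div_of_nonneg_left (by norm_num) (by norm_num) this
      linarith
    have hf0 : 0 ≤ 1 + 2 / Real.log ((4 : ℝ) ^ 18) := by
      have := log_four_pow_18_bounds.1
      have : 0 ≤ 2 / Real.log ((4 : ℝ) ^ 18) := by positivity
      linarith
    have hs1 : 1 ≤ √(min (((19 * 10 ^ 13 : ℕ)) : ℝ) ((10 : ℝ) ^ 14)) := by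
      rw [← Real.sqrt_one]; refine Real.sqrt_le_sqrt (le_min ?_ ?_) <;> norm_num
    have hs : √(min (((19 * 10 ^ 13 : ℕ)) : ℝ) ((10 : ℝ) ^ 14)) ≤ (10 : ℝ) ^ 7 := by
      refine (Real.sqrt_le_sqrt (min_le_right _ _)).trans ?_
      exact (sqrt_between (s := 0) (by norm_num) (by norm_num) (by norm_num)).2
    have hch := half_add_inv_le hs1 hs
    have hch0 : 0 ≤ (√(min (((19 * 10 ^ 13 : ℕ)) : ℝ) ((10 : ℝ) ^ 14)) + (√(min (((19 * 10 ^ 13 : ℕ)) : ℝ) ((10 : ℝ) ^ 14)))⁻¹) / 2 := by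
      positivity
    calc (1 + 2 / Real.log ((4 : ℝ) ^ 18)) *
          (((Real.log (T / (2 * π)) + 1) / (π * T) + (184 + 30 * Real.log T) / T ^ 2) * ((√(min (((19 * 10 ^ 13 : ℕ)) : ℝ) ((10 : ℝ) ^ 14)) +
            (√(min (((19 * 10 ^ 13 : ℕ)) : ℝ) ((10 : ℝ) ^ 14)))⁻¹) / 2))
          ≤ (1 + 2 / 24.95) * ((21 / (3.141592 * 545439823)) * (((10 : ℝ) ^ 7 + 1) / 2)) :=
          mul_le_mul hf (mul_le_mul ht' hch hch0 (by norm_num)) (mul_nonneg ht0 hch0) (by norm_num)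
      _ ≤ 0.0773 := by norm_num
  · intro _
    have hf : 1 + 2 / Real.log ((10 : ℝ) ^ 14) ≤ 1 + 2 / 32.236 := by
      have := log_ten_pow_14_bounds.1
      have h : 2 / Real.log ((10 : ℝ) ^ 14) ≤ 2 / 32.236 := div_le_div_of_nonneg_left (by norm_num) (by norm_num) this
      linarith
    have hs1 : 1 ≤ √(min (((19 * 10 ^ 13 : ℕ)) : ℝ) (2 * (10 : ℝ) ^ 19)) := by
      rw [← Real.sqrt_one]; refine Real.sqrt_le_sqrt (le_min ?_ ?_) <;> norm_num
    have hs : √(min (((19 * 10 ^ 13 : ℕ)) : ℝ) (2 * (10 : ℝ) ^ 19)) ≤ 13784049 := by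
      refine (Real.sqrt_le_sqrt (min_le_left _ _)).trans ?_
      push_cast
      exact (sqrt_between (s := 0) (by norm_num) (by norm_num) (by norm_num)).2
    have hch := half_add_inv_le hs1 hs
    have hch0 : 0 ≤ (√(min (((19 * 10 ^ 13 : ℕ)) : ℝ) (2 * (10 : ℝ) ^ 19)) +
        (√(min (((19 * 10 ^ 13 : ℕ)) : ℝ) (2 * (10 : ℝ) ^ 19)))⁻¹) / 2 := by positivity
    calc (1 + 2 / Real.log ((10 : ℝ) ^ 14)) *
          (((Real.log (T / (2 * π)) + 1) / (π * T) + (184 + 30 * Real.log T) / T ^ 2) * ((√(min (((19 * 10 ^ 13 : ℕ)) : ℝ) (2 * (10 : ℝ) ^ 19)) +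
            (√(min (((19 * 10 ^ 13 : ℕ)) : ℝ) (2 * (10 : ℝ) ^ 19)))⁻¹) / 2))
          ≤ (1 + 2 / 32.236) * ((21 / (3.141592 * 545439823)) * ((13784049 + 1) / 2)) :=
          mul_le_mul hf (mul_le_mul ht' hch hch0 (by norm_num)) (mul_nonneg ht0 hch0) (by norm_num)
      _ ≤ 0.0904 := by norm_num
  · intro h; exfalso; push_cast at h; norm_num at h

/-- **R2h · RH to Platt's 2017 rigorous height `30 610 046 000` ⟹ Robin at every CA number `> 5040` with primes `≤ 4.2·10¹⁷`**
(ramp 1b: `tailH ≤ 25/(πT) = 2.6·10⁻¹⁰`, `(1 + 2/32.236)·tailH·(√(4.2·10¹⁷) + 1)/2 ≤ 0.0895`).  Tree at the same height: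
`≤ 10¹⁷` (`robinCA_below_of_rhPlatt2017`). -/
theorem robinCA_below_of_rhPlatt2017_refl (h16 : Buthe2016_thm2) (hB : Buthe2018_thm2_theta)
    (hK : BroadbentEtAl2021_theta_rel_1e19) {T : ℝ} (hT : 30610046000 ≤ T) (hRH : RiemannHypothesisUpTo T) :
    robinCA_below (42 * 10 ^ 16 + 1) := by
  have hπ := Real.pi_gt_d6
  have hT5 : (100000 : ℝ) ≤ T := by linarith
  have hT7 : (7 : ℝ) ≤ T := by linarith
  have ht0 := tailH_nonneg hT7
  have ht := tailH_le_of_height (n := 25) (by norm_num) (by norm_num) hT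
  have ht' : ((Real.log (T / (2 * π)) + 1) / (π * T) + (184 + 30 * Real.log T) / T ^ 2) ≤ 25 / (3.141592 * 30610046000) :=
    ht.trans (div_le_div_of_nonneg_left (by norm_num) (by positivity) (by nlinarith))
  have hmain := robinCA_below_low_refl h16 hB hK hT5 hRH (X := 42 * 10 ^ 16) ?_ ?_ ?_ ?_
  · exact hmain
  · intro k hk11 hk17 _
    refine level_of_tolR hk11 hk17 (ht'.trans ?_)
    interval_cases k <;> · simp only [tolR]; push_cast; norm_num
  · intro _
    have hf : 1 + 2 / Real.log ((4 : ℝ) ^ 18) ≤ 1 + 2 / 24.95 := by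
      have := log_four_pow_18_bounds.1
      have h : 2 / Real.log ((4 : ℝ) ^ 18) ≤ 2 / 24.95 := div_le_div_of_nonneg_left (by norm_num) (by norm_num) this
      linarith
    have hs1 : 1 ≤ √(min (((42 * 10 ^ 16 : ℕ)) : ℝ) ((10 : ℝ) ^ 14)) := by
      rw [← Real.sqrt_one]; refine Real.sqrt_le_sqrt (le_min ?_ ?_) <;> norm_num
    have hs : √(min (((42 * 10 ^ 16 : ℕ)) : ℝ) ((10 : ℝ) ^ 14)) ≤ (10 : ℝ) ^ 7 := by
      refine (Real.sqrt_le_sqrt (min_le_right _ _)).trans ?_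
      exact (sqrt_between (s := 0) (by norm_num) (by norm_num) (by norm_num)).2
    have hch := half_add_inv_le hs1 hs
    have hch0 : 0 ≤ (√(min (((42 * 10 ^ 16 : ℕ)) : ℝ) ((10 : ℝ) ^ 14)) + (√(min (((42 * 10 ^ 16 : ℕ)) : ℝ) ((10 : ℝ) ^ 14)))⁻¹) / 2 := by
      positivity
    calc (1 + 2 / Real.log ((4 : ℝ) ^ 18)) *
          (((Real.log (T / (2 * π)) + 1) / (π * T) + (184 + 30 * Real.log T) / T ^ 2) * ((√(min (((42 * 10 ^ 16 : ℕ)) : ℝ) ((10 : ℝ) ^ 14)) +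
            (√(min (((42 * 10 ^ 16 : ℕ)) : ℝ) ((10 : ℝ) ^ 14)))⁻¹) / 2))
          ≤ (1 + 2 / 24.95) * ((25 / (3.141592 * 30610046000)) * (((10 : ℝ) ^ 7 + 1) / 2)) :=
          mul_le_mul hf (mul_le_mul ht' hch hch0 (by norm_num)) (mul_nonneg ht0 hch0) (by norm_num)
      _ ≤ 0.0773 := by norm_num
  · intro _
    have hf : 1 + 2 / Real.log ((10 : ℝ) ^ 14) ≤ 1 + 2 / 32.236 := by
      have := log_ten_pow_14_bounds.1
      have h : 2 / Real.log ((10 : ℝ) ^ 14) ≤ 2 / 32.236 := div_le_div_of_nonneg_left (by norm_num) (by norm_num) this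
      linarith
    have hs1 : 1 ≤ √(min (((42 * 10 ^ 16 : ℕ)) : ℝ) (2 * (10 : ℝ) ^ 19)) := by
      rw [← Real.sqrt_one]; refine Real.sqrt_le_sqrt (le_min ?_ ?_) <;> norm_num
    have hs : √(min (((42 * 10 ^ 16 : ℕ)) : ℝ) (2 * (10 : ℝ) ^ 19)) ≤ 648074070 := by
      refine (Real.sqrt_le_sqrt (min_le_left _ _)).trans ?_
      push_cast
      exact (sqrt_between (s := 0) (by norm_num) (by norm_num) (by norm_num)).2
    have hch := half_add_inv_le hs1 hs
    have hch0 : 0 ≤ (√(min (((42 * 10 ^ 16 : ℕ)) : ℝ) (2 * (10 : ℝ) ^ 19)) +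
        (√(min (((42 * 10 ^ 16 : ℕ)) : ℝ) (2 * (10 : ℝ) ^ 19)))⁻¹) / 2 := by positivity
    calc (1 + 2 / Real.log ((10 : ℝ) ^ 14)) *
          (((Real.log (T / (2 * π)) + 1) / (π * T) + (184 + 30 * Real.log T) / T ^ 2) * ((√(min (((42 * 10 ^ 16 : ℕ)) : ℝ) (2 * (10 : ℝ) ^ 19)) +
            (√(min (((42 * 10 ^ 16 : ℕ)) : ℝ) (2 * (10 : ℝ) ^ 19)))⁻¹) / 2))
          ≤ (1 + 2 / 32.236) * ((25 / (3.141592 * 30610046000)) * ((648074070 + 1) / 2)) :=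
          mul_le_mul hf (mul_le_mul ht' hch hch0 (by norm_num)) (mul_nonneg ht0 hch0) (by norm_num)
      _ ≤ 0.0904 := by norm_num
  · intro h; exfalso; push_cast at h; norm_num at h

/-! ### R2 · all-integer currency (tree `robin_all_of_robinCA_below_low`, unchanged bridge) -/

/-- **R2i · RH to height `10⁶` ⟹ Robin's inequality for every `5040 < n ≤ 10^(7·10⁹)`** (cells to `4¹⁷`; `7·10⁹·log 10 ≤
0.99947·(4¹⁷ − 2)`).  Tree at the same height: `n ≤ 10^(10⁹)` (`robin_le_of_rh6`). -/
theorem robin_le_of_rh6_refl (h16 : Buthe2016_thm2) (hB : Buthe2018_thm2_theta)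
    (hK : BroadbentEtAl2021_theta_rel_1e19) {T : ℝ} (hT : 1000000 ≤ T) (hRH : RiemannHypothesisUpTo T) :
    ∀ n : ℕ, 5040 < n → n ≤ 10 ^ (7 * 10 ^ 9) → robinInequality n := by
  have hRB : robinCA_below (4 ^ 17 - 1 + 1) := by
    rw [Nat.sub_add_cancel (Nat.one_le_pow _ _ (by norm_num))]
    exact robinCA_below_of_rh860000_refl h16 hB hK (by linarith) hRH
  intro n hn hle
  have hn0 : 0 < n := lt_of_le_of_lt (Nat.zero_le 5040) hn
  have h1 : Real.log n ≤ ((7 * 10 ^ 9 : ℕ) : ℝ) * Real.log 10 := log_le_of_le_ten_pow hn0 hle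
  clear hle
  refine robin_all_of_robinCA_below_low hB hK hRB (by norm_num) n hn ?_
  have h10 := RobinAnalytic.log_ten_lt
  have hc : (((4 : ℕ) ^ 17 - 1 : ℕ) : ℝ) = (4 : ℝ) ^ 17 - 1 := by
    rw [Nat.cast_pred (by positivity)]; push_cast; ring
  rw [hc]
  have h9 : ((7 * 10 ^ 9 : ℕ) : ℝ) = 7e9 := by norm_num
  rw [h9] at h1
  linarith

/-- **R2j · RH to the 1986 height `545 439 823` ⟹ Robin's inequality for every `5040 < n ≤ 10^(8·10¹³)`**
(`robinCA_below_of_rh1986_refl`; `8·10¹³·log 10 ≤ 0.99947·(1.9·10¹⁴ − 1)`).  Tree at the same height: `n ≤ 10^(1.4·10¹³)`. -/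
theorem robin_le_of_rh1986_refl (h16 : Buthe2016_thm2) (hB : Buthe2018_thm2_theta)
    (hK : BroadbentEtAl2021_theta_rel_1e19) {T : ℝ} (hT : 545439823 ≤ T) (hRH : RiemannHypothesisUpTo T) :
    ∀ n : ℕ, 5040 < n → n ≤ 10 ^ (8 * 10 ^ 13) → robinInequality n := by
  have hRB := robinCA_below_of_rh1986_refl h16 hB hK hT hRH
  intro n hn hle
  have hn0 : 0 < n := lt_of_le_of_lt (Nat.zero_le 5040) hn
  have h1 : Real.log n ≤ ((8 * 10 ^ 13 : ℕ) : ℝ) * Real.log 10 := log_le_of_le_ten_pow hn0 hle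
  clear hle
  refine robin_all_of_robinCA_below_low hB hK hRB (by norm_num) n hn ?_
  have h10 := RobinAnalytic.log_ten_lt
  have h9 : ((8 * 10 ^ 13 : ℕ) : ℝ) = 8e13 := by norm_num
  have hX : (((19 * 10 ^ 13 : ℕ)) : ℝ) = 1.9e14 := by norm_num
  rw [h9] at h1
  rw [hX]
  linarith

/-- **R2k · RH to Platt's 2017 height `30 610 046 000` ⟹ Robin's inequality for every `5040 < n ≤ 10^(1.8·10¹⁷)`**
(`robinCA_below_of_rhPlatt2017_refl`; `1.8·10¹⁷·log 10 ≤ 0.99947·(4.2·10¹⁷ − 1)`).  Tree at the same height: `n ≤ 10^(4·10¹⁶)`. -/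
theorem robin_le_of_rhPlatt2017_refl (h16 : Buthe2016_thm2) (hB : Buthe2018_thm2_theta)
    (hK : BroadbentEtAl2021_theta_rel_1e19) {T : ℝ} (hT : 30610046000 ≤ T) (hRH : RiemannHypothesisUpTo T) :
    ∀ n : ℕ, 5040 < n → n ≤ 10 ^ (18 * 10 ^ 16) → robinInequality n := by
  have hRB := robinCA_below_of_rhPlatt2017_refl h16 hB hK hT hRH
  intro n hn hle
  have hn0 : 0 < n := lt_of_le_of_lt (Nat.zero_le 5040) hn
  have h1 : Real.log n ≤ ((18 * 10 ^ 16 : ℕ) : ℝ) * Real.log 10 := log_le_of_le_ten_pow hn0 hle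
  clear hle
  refine robin_all_of_robinCA_below_low hB hK hRB (by norm_num) n hn ?_
  have h10 := RobinAnalytic.log_ten_lt
  have h9 : ((18 * 10 ^ 16 : ℕ) : ℝ) = 1.8e17 := by norm_num
  have hX : (((42 * 10 ^ 16 : ℕ)) : ℝ) = 4.2e17 := by norm_num
  rw [h9] at h1
  rw [hX]
  linarith

/-! ### Axiom guards (standard triple; no `sorryAx`, no new axiom) -/

/-- info: 'Summit.RiemannHypothesis.RiemannHypothesis.Theorems.Splittings.RobinFiniteC1.offLine_eq_tsum_symm' depends on axioms: [propext, Classical.choice, Quot.sound] -/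
#guard_msgs (whitespace := lax) in
#print axioms offLine_eq_tsum_symm

/-- info: 'Summit.RiemannHypothesis.RiemannHypothesis.Theorems.Splittings.RobinFiniteC1.robinCA_below_of_rh1620000_refl' depends on axioms: [propext, Classical.choice, Quot.sound] -/
#guard_msgs (whitespace := lax) in
#print axioms robinCA_below_of_rh1620000_refl

/-- info: 'Summit.RiemannHypothesis.RiemannHypothesis.Theorems.Splittings.RobinFiniteC1.robinCA_below_of_rh1986_refl' depends on axioms: [propext, Classical.choice, Quot.sound] -/
#guard_msgs (whitespace := lax) in
#print axioms robinCA_below_of_rh1986_refl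

/-- info: 'Summit.RiemannHypothesis.RiemannHypothesis.Theorems.Splittings.RobinFiniteC1.robin_le_of_rhPlatt2017_refl' depends on axioms: [propext, Classical.choice, Quot.sound] -/
#guard_msgs (whitespace := lax) in
#print axioms robin_le_of_rhPlatt2017_refl

end ReflLowRanges

end Summit.RiemannHypothesis.RiemannHypothesis.Theorems.Splittings.RobinFiniteC1

end
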